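import Mathlib
import Summits.QuantumFields.BalabanUV.Beta.EriceRemainderEnclosureHistoryAutonomyComparisonAgeCompositionStaticChainPairTemplate
import Summits.QuantumFields.BalabanUV.Beta.EriceRemainderEnclosureHistoryAutonomyComparisonAgeCompositionStaticChainPairsP1
import Summits.QuantumFields.BalabanUV.Beta.EriceRemainderEnclosureHistoryAutonomyComparisonAgeCompositionStaticChainPairsP2
import Summits.QuantumFields.BalabanUV.Beta.EriceRemainderEnclosureHistoryAutonomyComparisonAgeCompositionStaticChainPairsP3
import Summits.QuantumFields.BalabanUV.Beta.EriceRemainderEnclosureHistoryAutonomyComparisonAgeCompositionStaticChainPairsP4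
import Summits.QuantumFields.BalabanUV.Beta.EriceRemainderEnclosureHistoryAutonomyComparisonAgeCompositionStaticChainPairsP5
import Summits.QuantumFields.BalabanUV.Beta.EriceRemainderEnclosureHistoryAutonomyComparisonAgeCompositionStaticChainPairsP6

/-!
# EriceRemainderEnclosureHistoryAutonomyComparisonAgeCompositionStaticChainPairsSmall — (E79zb) THE OBSERVER STEP ABOVE EACH OF THE 27 RESIDUAL SMALL PAIRS
# (the non-adjacent pairs with `q ≤ 8` below every band threshold), from the pair template (E79y) and the packages (E79z1–z6)

Cell `pub-balaban`, β-function sub-cell, BINDER row D4 «RemainderConst leaves for Bałaban's split» (`HOME/BINDER-OWNERS.md`; owner lineage `b2b-balaban-beta-an4`;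
this file by co-owner #2 lineage `b2b-balaban-beta-d4-p2`, generation 70), β-FLOW TEAM duty (1), FREEZE (0) honoured (def-free; imports (E79y) `…PairTemplate`
(`pair_pair_step_lattice`) and (E79z1–z6) `…PairsP1…P6` (the 27 packages); nothing restated).

HONEST FRAMING (page 1, verbatim and binding).  *"Discharging BetaPertH makes Bałaban's UV stability UNCONDITIONAL — a real constructive-QFT result; it is
NOT the continuum limit and NOT the Clay problem."*  THIS FILE DISCHARGES NOTHING OF THE KIND.  A 27-way case analysis plus tree theorems — hypotheses of a
census, not facts; the age profile of Bałaban's (1.22) limit functional is NOT PRINTED ([I] p. 298; GAPS G-t4-U2-1∕-2) and NOT asserted.  Row D4 class UNCHANGED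
(critical-path width 0; instance 0∕1; D4 DISCHARGE NO DATE).  HONEST DEPENDENCY: continuum YM on T⁴ ⇐ BetaPertH ∧ nine spine estimates (0/9 proved); BetaPertH ⇐
(D1) ∧ (D4) ∧ CAP+tail; G-an2-4 gates asym, D1 and NE2/3/4.

THE POINT (census sense (α); route (N′); README `HOME/b2b-balaban-beta-d4-p2/g70/e79/README.md` §1, §4).  The regional theorems of this station cover every pair of
scales with `q = y∕z ≤ 8` EXCEPT exactly 27 small pairs (below every band threshold; enumeration in the README): **`pair_step_lattice_residual`** closes them —
given `(y, z)` among the 27 (a disjunction hypothesis), the observer step (◆) holds for every level-coupled configuration above the pair and every admissible load,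
with the natural defect hypothesis `θ ≤ θ̄(y∕z)`.  So after this file the step inequality of the observer induction is a tree theorem for EVERY pair with `q ≤ 8`,
in four regional forms: (E79g) adjacent; (E79t) `y ≥ 24`; (E79za) low-threshold bands; this file.  WHAT REMAINS for route (N′) at first order: the union as one
theorem (finite dispatch), the far pairs `q > 8`, the assembly of the induction; then identification with the flow and MONO∕MONO′.  NOT CLAIMED: those; printed.

WHAT IS PROVED ([folklore]; 0 `def`, 0 sorry).  **`pair_step_lattice_residual`**.
-/
noncomputable section
open Finset

namespace Summit.QuantumFields.BalabanUV.Beta.EriceRemainderEnclosureHistoryAutonomyComparisonAgeCompositionStaticChainPairsSmall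

open Summit.QuantumFields.BalabanUV.Beta.EriceRemainderEnclosureHistoryAutonomyComparisonAgeCompositionStaticChainPairTemplate

/-- **THE OBSERVER STEP (◆) ABOVE EACH RESIDUAL SMALL PAIR** `(3,1) (4,1) (4,2) (5,1) (5,2) (5,3) (6,1) (6,2) (6,3) (6,4) (7,1) (7,2) (7,3) (7,4) (7,5) (8,1) (9,7) (10,8)
(11,9) (14,2) (14,12) (15,2) (15,13) (16,2) (21,3) (22,3) (23,3)`, every level-coupled configuration, every admissible load, natural defect hypothesis `θ ≤ θ̄(y∕z)`:
case by case through (E79y) `pair_pair_step_lattice` with `pfacts_y_z` of (E79z1–z6). [folklore] -/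
theorem pair_step_lattice_residual {n y z : ℕ} {k : ℕ → ℕ} {x a cy cz Sy Sz Ry Rz : ℕ → ℝ} {θ xy Ψyy Ψyz Ψzy Ψzz Ωz σ φ s : ℝ}
    (hres : (y = 3 ∧ z = 1) ∨
      (y = 4 ∧ z = 1) ∨
      (y = 4 ∧ z = 2) ∨
      (y = 5 ∧ z = 1) ∨
      (y = 5 ∧ z = 2) ∨
      (y = 5 ∧ z = 3) ∨
      (y = 6 ∧ z = 1) ∨
      (y = 6 ∧ z = 2) ∨
      (y = 6 ∧ z = 3) ∨
      (y = 6 ∧ z = 4) ∨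
      (y = 7 ∧ z = 1) ∨
      (y = 7 ∧ z = 2) ∨
      (y = 7 ∧ z = 3) ∨
      (y = 7 ∧ z = 4) ∨
      (y = 7 ∧ z = 5) ∨
      (y = 8 ∧ z = 1) ∨
      (y = 9 ∧ z = 7) ∨
      (y = 10 ∧ z = 8) ∨
      (y = 11 ∧ z = 9) ∨
      (y = 14 ∧ z = 2) ∨
      (y = 14 ∧ z = 12) ∨
      (y = 15 ∧ z = 2) ∨
      (y = 15 ∧ z = 13) ∨
      (y = 16 ∧ z = 2) ∨
      (y = 21 ∧ z = 3) ∨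
      (y = 22 ∧ z = 3) ∨
      (y = 23 ∧ z = 3))
    (hn : 0 < n) (hk : ∀ l, l < n → y + 1 ≤ k l) (hx : ∀ l, l < n → 0 ≤ x l)
    (hSy : ∀ l, l < n → Sy l = ∑ m ∈ range y, Real.sqrt ((k l : ℝ) / ((k l : ℝ) + m + 1)))
    (hSz : ∀ l, l < n → Sz l = ∑ m ∈ range z, Real.sqrt ((k l : ℝ) / ((k l : ℝ) + m + 1)))
    (hRy : ∀ l, l < n → Ry l = ∑ m ∈ range (k l), Real.sqrt ((y : ℝ) / ((y : ℝ) + m + 1)))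
    (hRz : ∀ l, l < n → Rz l = ∑ m ∈ range (k l), Real.sqrt ((z : ℝ) / ((z : ℝ) + m + 1)))
    (ha0 : ∀ i, i < n → 0 < a i)
    (ha : ∀ i, i < n → a i = 1 + ∑ l ∈ range n,
      (2 * x l * (∑ m ∈ range (k i), Real.sqrt ((k l : ℝ) / ((k l : ℝ) + m + 1))) / k l) * a l)
    (hcy : ∀ i, i < n → cy i = Ry i / (y : ℝ) + ∑ l ∈ range n,
      (2 * x l * (∑ m ∈ range (k i), Real.sqrt ((k l : ℝ) / ((k l : ℝ) + m + 1))) / k l) * cy l)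
    (hcz : ∀ i, i < n → cz i = Rz i / (z : ℝ) + ∑ l ∈ range n,
      (2 * x l * (∑ m ∈ range (k i), Real.sqrt ((k l : ℝ) / ((k l : ℝ) + m + 1))) / k l) * cz l)
    (hΨyy : Ψyy = ∑ l ∈ range n, (2 * x l * Sy l / k l) * cy l) (hΨyz : Ψyz = ∑ l ∈ range n, (2 * x l * Sz l / k l) * cy l)
    (hΨzy : Ψzy = ∑ l ∈ range n, (2 * x l * Sy l / k l) * cz l) (hΨzz : Ψzz = ∑ l ∈ range n, (2 * x l * Sz l / k l) * cz l)
    (hΩz : Ωz = ∑ l ∈ range n, x l * (z : ℝ) / k l)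
    (hσ : σ = (∑ m ∈ range z, Real.sqrt ((y : ℝ) / ((y : ℝ) + m + 1))) / (y : ℝ))
    (hφ : φ = (∑ m ∈ range y, Real.sqrt ((z : ℝ) / ((z : ℝ) + m + 1))) / (z : ℝ))
    (hs : s = (∑ m ∈ range y, Real.sqrt ((y : ℝ) / ((y : ℝ) + m + 1))) / (y : ℝ))
    (hθ : θ ≤ 1 - ((y : ℝ) / z) / ((y : ℝ) / z + 1) * Real.sqrt (((y : ℝ) / z) / ((y : ℝ) / z + 1)) * Real.exp (-(1 / (2 * ((y : ℝ) / z)))))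
    (hxy : 0 ≤ xy) (hcap : 2 * xy * (s + Ψyy) < 1) :
    (1 + 2 * (31/40:ℝ) * Ψzz) * (1 - Ωz) - (1 - θ) * (xy * (1 + 2 * (31/40:ℝ) * Ψyy))
      ≤ (1 - xy * (1 + 2 * (31/40:ℝ) * Ψyy)) *
        ((1 + 2 * (31/40:ℝ) * Ψzz + 4 * (31/40:ℝ) * xy * ((σ + Ψyz) * (φ + Ψzy)) / (1 - 2 * (s + Ψyy) * xy)) * ((1 - Ωz) - xy / ((y : ℝ) / (z : ℝ)))) := by
  rcases hres with ⟨rfl, rfl⟩ | ⟨rfl, rfl⟩ | ⟨rfl, rfl⟩ | ⟨rfl, rfl⟩ | ⟨rfl, rfl⟩ | ⟨rfl, rfl⟩ | ⟨rfl, rfl⟩ | ⟨rfl, rfl⟩ | ⟨rfl, rfl⟩ | ⟨rfl, rfl⟩ | ⟨rfl, rfl⟩ | ⟨rfl, rfl⟩ | ⟨rfl, rfl⟩ | ⟨rfl, rfl⟩ | ⟨rfl, rfl⟩ | ⟨rfl, rfl⟩ | ⟨rfl, rfl⟩ | ⟨rfl, rfl⟩ | ⟨rfl, rfl⟩ | ⟨rfl,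 rfl⟩ | ⟨rfl, rfl⟩ | ⟨rfl, rfl⟩ | ⟨rfl, rfl⟩ | ⟨rfl, rfl⟩ | ⟨rfl, rfl⟩ | ⟨rfl, rfl⟩ | ⟨rfl, rfl⟩
  · exact pair_pair_step_lattice (by norm_num) (by norm_num) Summit.QuantumFields.BalabanUV.Beta.EriceRemainderEnclosureHistoryAutonomyComparisonAgeCompositionStaticChainPairsP1.pfacts_3_1 hn hk hx hSy hSz hRy hRz ha0 ha hcy hcz hΨyy hΨyz hΨzy hΨzz hΩz hσ hφ hs hθ hxy hcap
  · exact pair_pair_step_lattice (by norm_num) (by norm_num) Summit.QuantumFields.BalabanUV.Beta.EriceRemainderEnclosureHistoryAutonomyComparisonAgeCompositionStaticChainPairsP1.pfacts_4_1 hn hk hx hSy hSz hRy hRz ha0 ha hcy hcz hΨyy hΨyz hΨzy hΨzz hΩz hσ hφ hs hθ hxy hcap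
  · exact pair_pair_step_lattice (by norm_num) (by norm_num) Summit.QuantumFields.BalabanUV.Beta.EriceRemainderEnclosureHistoryAutonomyComparisonAgeCompositionStaticChainPairsP1.pfacts_4_2 hn hk hx hSy hSz hRy hRz ha0 ha hcy hcz hΨyy hΨyz hΨzy hΨzz hΩz hσ hφ hs hθ hxy hcap
  · exact pair_pair_step_lattice (by norm_num) (by norm_num) Summit.QuantumFields.BalabanUV.Beta.EriceRemainderEnclosureHistoryAutonomyComparisonAgeCompositionStaticChainPairsP1.pfacts_5_1 hn hk hx hSy hSz hRy hRz ha0 ha hcy hcz hΨyy hΨyz hΨzy hΨzz hΩz hσ hφ hs hθ hxy hcap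
  · exact pair_pair_step_lattice (by norm_num) (by norm_num) Summit.QuantumFields.BalabanUV.Beta.EriceRemainderEnclosureHistoryAutonomyComparisonAgeCompositionStaticChainPairsP1.pfacts_5_2 hn hk hx hSy hSz hRy hRz ha0 ha hcy hcz hΨyy hΨyz hΨzy hΨzz hΩz hσ hφ hs hθ hxy hcap
  · exact pair_pair_step_lattice (by norm_num) (by norm_num) Summit.QuantumFields.BalabanUV.Beta.EriceRemainderEnclosureHistoryAutonomyComparisonAgeCompositionStaticChainPairsP2.pfacts_5_3 hn hk hx hSy hSz hRy hRz ha0 ha hcy hcz hΨyy hΨyz hΨzy hΨzz hΩz hσ hφ hs hθ hxy hcap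
  · exact pair_pair_step_lattice (by norm_num) (by norm_num) Summit.QuantumFields.BalabanUV.Beta.EriceRemainderEnclosureHistoryAutonomyComparisonAgeCompositionStaticChainPairsP2.pfacts_6_1 hn hk hx hSy hSz hRy hRz ha0 ha hcy hcz hΨyy hΨyz hΨzy hΨzz hΩz hσ hφ hs hθ hxy hcap
  · exact pair_pair_step_lattice (by norm_num) (by norm_num) Summit.QuantumFields.BalabanUV.Beta.EriceRemainderEnclosureHistoryAutonomyComparisonAgeCompositionStaticChainPairsP2.pfacts_6_2 hn hk hx hSy hSz hRy hRz ha0 ha hcy hcz hΨyy hΨyz hΨzy hΨzz hΩz hσ hφ hs hθ hxy hcap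
  · exact pair_pair_step_lattice (by norm_num) (by norm_num) Summit.QuantumFields.BalabanUV.Beta.EriceRemainderEnclosureHistoryAutonomyComparisonAgeCompositionStaticChainPairsP2.pfacts_6_3 hn hk hx hSy hSz hRy hRz ha0 ha hcy hcz hΨyy hΨyz hΨzy hΨzz hΩz hσ hφ hs hθ hxy hcap
  · exact pair_pair_step_lattice (by norm_num) (by norm_num) Summit.QuantumFields.BalabanUV.Beta.EriceRemainderEnclosureHistoryAutonomyComparisonAgeCompositionStaticChainPairsP2.pfacts_6_4 hn hk hx hSy hSz hRy hRz ha0 ha hcy hcz hΨyy hΨyz hΨzy hΨzz hΩz hσ hφ hs hθ hxy hcap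
  · exact pair_pair_step_lattice (by norm_num) (by norm_num) Summit.QuantumFields.BalabanUV.Beta.EriceRemainderEnclosureHistoryAutonomyComparisonAgeCompositionStaticChainPairsP3.pfacts_7_1 hn hk hx hSy hSz hRy hRz ha0 ha hcy hcz hΨyy hΨyz hΨzy hΨzz hΩz hσ hφ hs hθ hxy hcap
  · exact pair_pair_step_lattice (by norm_num) (by norm_num) Summit.QuantumFields.BalabanUV.Beta.EriceRemainderEnclosureHistoryAutonomyComparisonAgeCompositionStaticChainPairsP3.pfacts_7_2 hn hk hx hSy hSz hRy hRz ha0 ha hcy hcz hΨyy hΨyz hΨzy hΨzz hΩz hσ hφ hs hθ hxy hcap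
  · exact pair_pair_step_lattice (by norm_num) (by norm_num) Summit.QuantumFields.BalabanUV.Beta.EriceRemainderEnclosureHistoryAutonomyComparisonAgeCompositionStaticChainPairsP3.pfacts_7_3 hn hk hx hSy hSz hRy hRz ha0 ha hcy hcz hΨyy hΨyz hΨzy hΨzz hΩz hσ hφ hs hθ hxy hcap
  · exact pair_pair_step_lattice (by norm_num) (by norm_num) Summit.QuantumFields.BalabanUV.Beta.EriceRemainderEnclosureHistoryAutonomyComparisonAgeCompositionStaticChainPairsP3.pfacts_7_4 hn hk hx hSy hSz hRy hRz ha0 ha hcy hcz hΨyy hΨyz hΨzy hΨzz hΩz hσ hφ hs hθ hxy hcap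
  · exact pair_pair_step_lattice (by norm_num) (by norm_num) Summit.QuantumFields.BalabanUV.Beta.EriceRemainderEnclosureHistoryAutonomyComparisonAgeCompositionStaticChainPairsP3.pfacts_7_5 hn hk hx hSy hSz hRy hRz ha0 ha hcy hcz hΨyy hΨyz hΨzy hΨzz hΩz hσ hφ hs hθ hxy hcap
  · exact pair_pair_step_lattice (by norm_num) (by norm_num) Summit.QuantumFields.BalabanUV.Beta.EriceRemainderEnclosureHistoryAutonomyComparisonAgeCompositionStaticChainPairsP4.pfacts_8_1 hn hk hx hSy hSz hRy hRz ha0 ha hcy hcz hΨyy hΨyz hΨzy hΨzz hΩz hσ hφ hs hθ hxy hcap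
  · exact pair_pair_step_lattice (by norm_num) (by norm_num) Summit.QuantumFields.BalabanUV.Beta.EriceRemainderEnclosureHistoryAutonomyComparisonAgeCompositionStaticChainPairsP4.pfacts_9_7 hn hk hx hSy hSz hRy hRz ha0 ha hcy hcz hΨyy hΨyz hΨzy hΨzz hΩz hσ hφ hs hθ hxy hcap
  · exact pair_pair_step_lattice (by norm_num) (by norm_num) Summit.QuantumFields.BalabanUV.Beta.EriceRemainderEnclosureHistoryAutonomyComparisonAgeCompositionStaticChainPairsP4.pfacts_10_8 hn hk hx hSy hSz hRy hRz ha0 ha hcy hcz hΨyy hΨyz hΨzy hΨzz hΩz hσ hφ hs hθ hxy hcap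
  · exact pair_pair_step_lattice (by norm_num) (by norm_num) Summit.QuantumFields.BalabanUV.Beta.EriceRemainderEnclosureHistoryAutonomyComparisonAgeCompositionStaticChainPairsP4.pfacts_11_9 hn hk hx hSy hSz hRy hRz ha0 ha hcy hcz hΨyy hΨyz hΨzy hΨzz hΩz hσ hφ hs hθ hxy hcap
  · exact pair_pair_step_lattice (by norm_num) (by norm_num) Summit.QuantumFields.BalabanUV.Beta.EriceRemainderEnclosureHistoryAutonomyComparisonAgeCompositionStaticChainPairsP4.pfacts_14_2 hn hk hx hSy hSz hRy hRz ha0 ha hcy hcz hΨyy hΨyz hΨzy hΨzz hΩz hσ hφ hs hθ hxy hcap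
  · exact pair_pair_step_lattice (by norm_num) (by norm_num) Summit.QuantumFields.BalabanUV.Beta.EriceRemainderEnclosureHistoryAutonomyComparisonAgeCompositionStaticChainPairsP5.pfacts_14_12 hn hk hx hSy hSz hRy hRz ha0 ha hcy hcz hΨyy hΨyz hΨzy hΨzz hΩz hσ hφ hs hθ hxy hcap
  · exact pair_pair_step_lattice (by norm_num) (by norm_num) Summit.QuantumFields.BalabanUV.Beta.EriceRemainderEnclosureHistoryAutonomyComparisonAgeCompositionStaticChainPairsP5.pfacts_15_2 hn hk hx hSy hSz hRy hRz ha0 ha hcy hcz hΨyy hΨyz hΨzy hΨzz hΩz hσ hφ hs hθ hxy hcap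
  · exact pair_pair_step_lattice (by norm_num) (by norm_num) Summit.QuantumFields.BalabanUV.Beta.EriceRemainderEnclosureHistoryAutonomyComparisonAgeCompositionStaticChainPairsP5.pfacts_15_13 hn hk hx hSy hSz hRy hRz ha0 ha hcy hcz hΨyy hΨyz hΨzy hΨzz hΩz hσ hφ hs hθ hxy hcap
  · exact pair_pair_step_lattice (by norm_num) (by norm_num) Summit.QuantumFields.BalabanUV.Beta.EriceRemainderEnclosureHistoryAutonomyComparisonAgeCompositionStaticChainPairsP5.pfacts_16_2 hn hk hx hSy hSz hRy hRz ha0 ha hcy hcz hΨyy hΨyz hΨzy hΨzz hΩz hσ hφ hs hθ hxy hcap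
  · exact pair_pair_step_lattice (by norm_num) (by norm_num) Summit.QuantumFields.BalabanUV.Beta.EriceRemainderEnclosureHistoryAutonomyComparisonAgeCompositionStaticChainPairsP6.pfacts_21_3 hn hk hx hSy hSz hRy hRz ha0 ha hcy hcz hΨyy hΨyz hΨzy hΨzz hΩz hσ hφ hs hθ hxy hcap
  · exact pair_pair_step_lattice (by norm_num) (by norm_num) Summit.QuantumFields.BalabanUV.Beta.EriceRemainderEnclosureHistoryAutonomyComparisonAgeCompositionStaticChainPairsP6.pfacts_22_3 hn hk hx hSy hSz hRy hRz ha0 ha hcy hcz hΨyy hΨyz hΨzy hΨzz hΩz hσ hφ hs hθ hxy hcap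
  · exact pair_pair_step_lattice (by norm_num) (by norm_num) Summit.QuantumFields.BalabanUV.Beta.EriceRemainderEnclosureHistoryAutonomyComparisonAgeCompositionStaticChainPairsP6.pfacts_23_3 hn hk hx hSy hSz hRy hRz ha0 ha hcy hcz hΨyy hΨyz hΨzy hΨzz hΩz hσ hφ hs hθ hxy hcap

end Summit.QuantumFields.BalabanUV.Beta.EriceRemainderEnclosureHistoryAutonomyComparisonAgeCompositionStaticChainPairsSmall

end
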